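import Summits.QuantumFields.YangMills.Theorems.BalabanUVNodesK0AxTangentSocket
import Summits.QuantumFields.YangMills.Theorems.BalabanUVNodesK0AxJunctionRootGradScheme

/-!
# NODE O · K0ᴬ — THE TANGENT SOCKET, OF-RECORD EDITION AND DOCKING: criticality in n07-e's CURVE form `Node00.IsCritOnFibre` (⟸ (2.12)-minimal) + n07-e's submersion letter
# ⟹ the flat tangent data; transport along (s-exp) `U =ᶠ expChart 1 ∘ X`; the four ROOTED receipts + TokP9reg♭ᵣ from {KNIT tokens, (s-exp), of-record family token, (J-crit′), (J-cons′)}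
# (FILE 5′ = §4c ONLY — the DOCKING leaf, for the case §4b lands as an APPEND to ✓`…K0AxTangentSocket` (INTENT-57); consumes that file and ✓`…K0AxJunctionRootGradScheme` (FILE 55) by name)

LANDING NOTE (porter ▶ PTC-1 g4, 2026-08-31; AUTHORSHIP = ◇ lens-1 g11 «cauchy-analytic», HOME sketch `nodeO-cover/LENS-1g11-TangentSocketDock-v1.lean` sha16 533b5c8d6b0a65d3 · 183 l. · 6 thm · 0
def · 0 sorry (CANDIDATE 3, §4c DOCKING)): landed VERBATIM (only this paragraph added) under the basename ◇ lens-1 proposed (`…Theorems/BalabanUVNodesK0AxTangentSocketDock.lean`) as INTENT-58,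
after ✓p821692 (the §4b APPEND to `…K0AxTangentSocket`) and ✓p821519 `…K0AxJunctionRootGradScheme`; `--supports stmt-QuantumFields-27238 --as helper` (NO `--workitem`; kind proof — no `def`); ◆
CRIT-1 g37's cut: «CANDIDATE 3 (§4c DOCKING) — SAME-WALL: SURVIVES as TRANSPORT (no new wall, no tautology); J1′ ∕ J4 ∕ J5′ ∕ (Q-ord) STAMP PASS; GO as the DOCK LEAF (v1 VERBATIM, not the combined
`…TangentSocketRec` edition); after this leaf NO weak-criticality letter, NO H₁, NO nondegeneracy, NO (21) slice, NO selector property is displayed on the (R-a) road» (nodeO STATUS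
2026-08-31T11:32:10Z); ◇ lens-1's later v2∕v3 additions (§4d `SchemeExp`, §4e `MinimalCritical`) land as ONE APPEND to this file on ◆'s next cut (INTENT-59).  CONTENT (lens-1): the (s-exp)
transport ◆ asked about LIVES HERE — `rootFactorAt_congr` + `chartRegAt_expChart` + `contDiffAt_coe_expChart_family`, then ★★★`rootedReceipts_of_critOnFibreFamily`, ★★`tokP9reg_of_expChartFamily`,
★★★`rootedReceipts_of_tokens_critOnFibreFamily`.  HONEST (porter): transport ∕ bookkeeping; CONDITIONAL over DISPLAYED letters (of-record family token, (J-crit′), (J-cons′), (s-exp), `ContDiffAt ℝ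
2 X 0`, KNIT∕def-Y tokens — inhabited NOWHERE); (C-tab-opt) STRUCK; nothing of Bałaban asserted, ported, discharged or refuted; K0ᴬ stmt-QuantumFields-27238 ∕ K0⁷ 20541 OPEN — NOTHING of them
proved; NODE O 0∕1; COUNT 8∕28 · K 1∕4 UNMOVED; finite 𝕋⁴ at fixed ε — NOT continuum ∕ OS ∕ Clay; the Yang–Mills mass gap is NOT proved by any of this.

◇ `ymgap-nodeO-lens-1` g11 (planner; typed for the porter ▶ PTC-1; proposed basename `…/Theorems/BalabanUVNodesK0AxTangentSocketDock.lean`,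
`--supports stmt-QuantumFields-27238 --as helper`).  Items: K0ᴬ stmt-QuantumFields-27238 OPEN; K0⁷ stmt-QuantumFields-20541 OPEN.  [15] = [Balaban1985Variational],
[I] = [Balaban1987RG1], [B6] = [Balaban1984PropagatorsII], [LF-II] = [Balaban1989LargeFieldII], [III] = [Balaban1988Convergent].

WHY.  ✓`…K0AxTangentSocket` (FILE 56) derives the content letter (p1) `ChartResponseWeaklyCriticalAt` of the (R-a) road for a chart `B ↦ expChart 1 (X B)` from the family token
`FlatCriticalExpChartFamilyAt` (members TANGENT-critical on `ker DΨ(X B)`, chart coordinates) + the two flat dictionaries.  ◆ CRIT-1 g37 (l.5250 ∕ corrected l.5265) priced the instance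
condition as «fibre membership + fibre-criticality of the chart members = (rng)+(min), NOT the (21) slice».  This file states the criticality input in the GAUGE-NATURAL currency OF RECORD —
n07-e's curve form `Node00.IsCritOnFibre F 2 K 𝐁 (W B) (expChart 1 (X B))` on CONFIGURATIONS (print's «critical configuration of (5) on the fibre 𝔅(𝐁, W)», [15] p.278 ∕ Prop. 8; obtained from
«(2.12)-minimal over the class (6)» by ✓`Node00.isCritOnFibre_of_isMinimizer_class6`) together with n07-e's submersion letter at every member (VERBATIM the `hchart` binder of N12's
✓`fderiv_minimiserExpChartFamily_eq_linearisedMinimiser_class6`) — and DOCKS the socket onto the road: the factorisation of ANY chart `U` (✓`RootFactorAt`; at def-Y's chart supplied by the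
N07∕P0 KNIT, ✓`rootFactorAt_of_tokens_chart`) transports along (s-exp) `U =ᶠ[𝓝 0] expChart 1 ∘ X`, exp-chart families are chart-regular (✓`Node00.contDiff_coeField_expChart`), and
✓`rootedReceipts_of_chart` ∕ ✓`contDiffAt_recordBgField_entries_of_chart` close the four receipts and TokP9reg♭ᵣ.  After this file the (R-a) road at def-Y's chart has NO weak-criticality
letter, NO `H₁`, NO nondegeneracy, NO (21) slice and NO selector property left: its displayed leaves are the KNIT tokens, (s-exp), the of-record family token (minimality∕criticality on fibres,
submersion letter, fibre clause, differentiability), the two finite flat dictionaries, D1 and the guards.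

WHAT IS PROVED (kernel, sorry-free, standard axioms; namespace `K0AxCtabUniq`).
§4b ★★ `flatCritical_tangentData_of_isCritOnFibre` (generic parameter space; N12 §3 ✓`fderiv_wilsonAction4_expChart_apply_eq_zero_of_isCritOnFibre` feeds ✓`flatCritical_tangentData`; «onto at
   `0`» and `DifferentiableAt ℝ Ψ 0` READ OFF the submersion letter at `g = 0`); displayed letter `FlatCritOnFibreExpChartFamilyAt` (of-record family token on the K0 parameter space);
   `flatCriticalExpChartFamilyAt_of_critOnFibre` (of-record ⟹ tangent form); ★★★ `chartResponseWeaklyCritical_of_critOnFibreFamily` (of-record token + (J-crit′) + (J-cons′) ⟹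
   `ChartResponseWeaklyCriticalAt`, all `a l`).
§4c `rootFactorAt_congr` (transport of the factorisation along `=ᶠ[𝓝 0]`), `chartRegAt_expChart`, `contDiffAt_coe_expChart_family` (regularity of exp-chart families); ★★★
   `rootedReceipts_of_critOnFibreFamily`: {factorisation of `U`, (s-exp), of-record token, (J-crit′), (J-cons′)} ⟹ (C-wcg) ∧ (C-orb) ∧ (C-crit) ∧ (C-cons); ★★ `tokP9reg_of_expChartFamily`:
   {factorisation, (s-exp), `C²` coordinates} ⟹ TokP9reg♭ᵣ; ★★★ `rootedReceipts_of_tokens_critOnFibreFamily`: the same two conclusions for ALL `a l` with the factorisation supplied by the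
   KNIT tokens (rng)(cov)(c→s)(min) + `S.RegimeTok` + domain letter at def-Y's `BgScheme`.

HONEST.  Calculus + logic; CONDITIONAL theorems over DISPLAYED letters inhabited NOWHERE (KNIT tokens, (s-exp), the of-record family token's minimality ∕ submersion ∕ fibre clauses = [15] Thm 1 +
(82)–(83) + n07-e's letter AT FLAT, the two dictionaries = finite normalisation identities — all OPEN); nothing of Bałaban ([15] Thm 1, Prop. 6–9, (176)–(178); [B6] (2.35); [LF-II] (1.12);
[III] (2.12); [I] (4.35)) is asserted, ported or discharged; (C-tab-opt) stays STRUCK; K0ᴬ 27238 ∕ K0⁷ 20541 OPEN — NOTHING of them proved; NODE O 0∕1; COUNT 8∕28 · K 1∕4 UNMOVED; finite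
𝕋⁴_{L^K} at fixed ε — NOT continuum ∕ OS ∕ Clay; **the Yang–Mills mass gap is NOT proved by any of this.**  No `sorry`, no `instance ∕ notation ∕ set_option`; standard axioms.
-/

noncomputable section

open Filter Topology
open scoped BigOperators Matrix.Norms.L2Operator

namespace Summit.QuantumFields.YangMills.Theorems.K0AxCtabUniq

open Literature.MathematicalPhysics.QuantumFieldTheory.Balaban1983to89
open LatticeFieldCalculus B6SectADomainsV1 B6SectAOperatorsV1 B6SectAVectorModelV1 B6SectACriticalPointV1
open Literature.MathematicalPhysics.QuantumFieldTheory.Balaban1983to89.T4Continuum (T4Family)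
open Literature.MathematicalPhysics.QuantumFieldTheory.Balaban1983to89.Node00
open T4RootedResidualGauge (rootGauge)
open GaugeField (gaugeAct)
open B12GaugeOrbits021 (IsResidual OrbitRel)
open B11Prop6Scheme (mapT)
open Summit.QuantumFields.YangMills.Theorems.K0RecordFormatNames
open Summit.QuantumFields.YangMills.Theorems.K0AxRootGrad

variable (F : T4Family) (θ : Stage13Params F 2)


/-! ### §4c  DOCKING: transport of the chart letters along (s-exp) `U =ᶠ[𝓝 0] expChart 1 ∘ X`, chart regularity of exp-chart families, and the four ROOTED receipts
+ TokP9reg♭ᵣ from {factorisation, (s-exp), of-record family token, (J-crit′), (J-cons′)} — generic, and at the N07∕P0 KNIT tokens -/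

section Docking

open T4AdjointCovarianceUnitary (lieSU expSU coe_expSU)
open B15DeterminingSets (DetSet MSField AgreeOn avgFamily)

/-- The factorisation token transports along eventual equality of charts at `B = 0` (bookkeeping for (s-exp)). [cite: Balaban1985Variational, (19) p.281 (bookkeeping)] -/
theorem rootFactorAt_congr (k K : ℕ) {U U' : (Fin (F.P K).d → Site (F.P K) (k + 1) → θ.Vβ) → GaugeField (F.P K) 0 (SU 2)}
    (hfac : RootFactorAt F θ k K U)
    (hUU' : letI := θ.instVβ₁; letI := θ.instVβ₂; U =ᶠ[𝓝 (0 : Fin (F.P K).d → Site (F.P K) (k + 1) → θ.Vβ)] U') :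
    RootFactorAt F θ k K U' := by
  letI := θ.instVβ₁; letI := θ.instVβ₂
  filter_upwards [hfac, hUU'] with B hB hB'
  rw [hB, hB']

/-- **Chart regularity of an exp-chart family**: `expChart 1 (X 0) = 1` and differentiable bond matrices at `0`, from `X 0 = 0` and `X` differentiable at `0`
(✓`Node00.contDiff_coeField_expChart`). [cite: Balaban1985RegularSpaces, (1.10) p.77 (bookkeeping)] -/
theorem chartRegAt_expChart (k K : ℕ) {X : (Fin (F.P K).d → Site (F.P K) (k + 1) → θ.Vβ) → PBond (F.P K) 0 → lieSU (Fin 2)}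
    (hX₀ : letI := θ.instVβ₁; letI := θ.instVβ₂; X 0 = 0) (hXd : letI := θ.instVβ₁; letI := θ.instVβ₂; DifferentiableAt ℝ X 0) :
    ChartRegAt F θ k K fun B => expChart (1 : GaugeField (F.P K) 0 (SU 2)) (X B) := by
  letI := θ.instVβ₁; letI := θ.instVβ₂
  refine ⟨?_, fun b => ?_⟩
  · show expChart (1 : GaugeField (F.P K) 0 (SU 2)) (X 0) = 1
    rw [hX₀, expChart_zero]
  · have h1 : DifferentiableAt ℝ (fun Y : PBond (F.P K) 0 → lieSU (Fin 2) => coeField (expChart (1 : GaugeField (F.P K) 0 (SU 2)) Y)) (X 0) :=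
      ((contDiff_coeField_expChart (1 : GaugeField (F.P K) 0 (SU 2))).differentiable (by simp)).differentiableAt
    have h2 := h1.comp (0 : Fin (F.P K).d → Site (F.P K) (k + 1) → θ.Vβ) hXd
    exact differentiableAt_pi.1 h2 b

/-- **`Cⁿ` bond matrices of an exp-chart family** from `Cⁿ` chart coordinates `X` at `0` (✓`Node00.contDiff_coeField_expChart`). [cite: Balaban1985RegularSpaces, (1.10) p.77 (bookkeeping)] -/
theorem contDiffAt_coe_expChart_family (k K : ℕ) {n : WithTop ℕ∞} {X : (Fin (F.P K).d → Site (F.P K) (k + 1) → θ.Vβ) → PBond (F.P K) 0 → lieSU (Fin 2)}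
    (hXc : letI := θ.instVβ₁; letI := θ.instVβ₂; ContDiffAt ℝ n X 0) :
    letI := θ.instVβ₁; letI := θ.instVβ₂
    ∀ b : PBond (F.P K) 0, ContDiffAt ℝ n (fun B : Fin (F.P K).d → Site (F.P K) (k + 1) → θ.Vβ =>
      ((expChart (1 : GaugeField (F.P K) 0 (SU 2)) (X B) b : SU 2) : MatA 2)) 0 := by
  letI := θ.instVβ₁; letI := θ.instVβ₂
  intro b
  have h1 : ContDiffAt ℝ n (fun Y : PBond (F.P K) 0 → lieSU (Fin 2) => coeField (expChart (1 : GaugeField (F.P K) 0 (SU 2)) Y)) (X 0) :=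
    ((contDiff_coeField_expChart (1 : GaugeField (F.P K) 0 (SU 2))).of_le le_top).contDiffAt
  have h2 := h1.comp (0 : Fin (F.P K).d → Site (F.P K) (k + 1) → θ.Vβ) hXc
  exact contDiffAt_pi.1 h2 b

/-- ★★★ **THE FOUR ROOTED RECEIPTS FROM {factorisation of ANY chart `U`, (s-exp) `U =ᶠ expChart 1 ∘ X`, the of-record family token, (J-crit′), (J-cons′)}** — the (R-a) leaves
(C-wcg) ∧ (C-orb) ∧ (C-crit) ∧ (C-cons) of ✓`K0AxJoinT.twoVolExp_orbit_images` at lattice `(k, K)`, `k + 1 ≤ m + K`, with NO weak-criticality letter left: criticality enters only as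
«members critical on their fibres» (n07-e's curve form; ⟸ (2.12)-minimal).  CONDITIONAL; every letter DISPLAYED. [cite: Balaban1985Variational, Thm 1 p.279, (82)–(83) p.290, (176)–(178) p.306, Prop. 8 p.304; Balaban1984PropagatorsII, (2.35) p.228; Balaban1988Convergent, (2.12) p.256; Balaban1987RG1, (4.35) p.290] -/
theorem rootedReceipts_of_critOnFibreFamily (k K : ℕ) (hk : k + 1 ≤ (F.P K).m + (F.P K).K)
    (U : (Fin (F.P K).d → Site (F.P K) (k + 1) → θ.Vβ) → GaugeField (F.P K) 0 (SU 2)) (hfac : RootFactorAt F θ k K U)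
    {V : Type*} [NormedAddCommGroup V] [NormedSpace ℝ V] [FiniteDimensional ℝ V]
    (𝔹 : DetSet (F.P K)) (W : (Fin (F.P K).d → Site (F.P K) (k + 1) → θ.Vβ) → MSField (F.P K) (SU 2))
    (X : (Fin (F.P K).d → Site (F.P K) (k + 1) → θ.Vβ) → PBond (F.P K) 0 → lieSU (Fin 2))
    (Ψ : (PBond (F.P K) 0 → lieSU (Fin 2)) → V) (datum : (Fin (F.P K).d → Site (F.P K) (k + 1) → θ.Vβ) → V)
    (hUX : letI := θ.instVβ₁; letI := θ.instVβ₂;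
      U =ᶠ[𝓝 (0 : Fin (F.P K).d → Site (F.P K) (k + 1) → θ.Vβ)] fun B => expChart (1 : GaugeField (F.P K) 0 (SU 2)) (X B))
    (hfam : FlatCritOnFibreExpChartFamilyAt F θ k K 𝔹 W X Ψ datum) (Jcrit : FlatCritDictionary F k K Ψ) (Jcons : FlatConsDictionary F θ k K Ψ datum)
    (a : θ.ιβ) (l : RespLabel F k K) :
    RootedResponseCriticalModGaugeAt F θ k K a l ∧ RootedResponseOrbitAt F θ k K a l ∧
      RootedResponseInvCriticalAt F θ k K a l ∧ RootedResponseConstraintModGaugeAt F θ k K a l :=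
  rootedReceipts_of_chart F θ k K hk _ (rootFactorAt_congr F θ k K hfac hUX) (chartRegAt_expChart F θ k K hfam.1 hfam.2.1) a l
    (chartResponseWeaklyCritical_of_critOnFibreFamily F θ k K 𝔹 W X Ψ datum hfam Jcrit Jcons a l)

/-- ★★ **TokP9reg♭ᵣ FROM {factorisation, (s-exp), `C²` chart coordinates}**: the displayed regularity letter of ✓`twoVolExp_orbit_images` (`C²` entries of `recordBgField` at `0`).
CONDITIONAL. [cite: Balaban1985Variational, Prop. 9 p.309, (19) p.281] -/
theorem tokP9reg_of_expChartFamily (k K : ℕ)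
    (U : (Fin (F.P K).d → Site (F.P K) (k + 1) → θ.Vβ) → GaugeField (F.P K) 0 (SU 2)) (hfac : RootFactorAt F θ k K U)
    (X : (Fin (F.P K).d → Site (F.P K) (k + 1) → θ.Vβ) → PBond (F.P K) 0 → lieSU (Fin 2))
    (hUX : letI := θ.instVβ₁; letI := θ.instVβ₂;
      U =ᶠ[𝓝 (0 : Fin (F.P K).d → Site (F.P K) (k + 1) → θ.Vβ)] fun B => expChart (1 : GaugeField (F.P K) 0 (SU 2)) (X B))
    (hXc : letI := θ.instVβ₁; letI := θ.instVβ₂; ContDiffAt ℝ 2 X 0) :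
    letI := θ.instVβ₁; letI := θ.instVβ₂
    ContDiffAt ℝ 2 (fun B : Fin (F.P K).d → Site (F.P K) (k + 1) → θ.Vβ =>
      fun (b : PBond (F.P K) 0) (i i' : Fin 2) => ((recordBgField F θ k K B b : SU 2) : Matrix (Fin 2) (Fin 2) ℂ) i i') 0 :=
  contDiffAt_recordBgField_entries_of_chart F θ k K _ (rootFactorAt_congr F θ k K hfac hUX) (contDiffAt_coe_expChart_family F θ k K hXc)

end Docking

section SchemeDocking

variable {𝒴 𝒵 : Type} [NormedAddCommGroup 𝒴] [NormedSpace ℂ 𝒴] [NormedAddCommGroup 𝒵] [NormedSpace ℂ 𝒵]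

open T4AdjointCovarianceUnitary (lieSU expSU coe_expSU)
open B15DeterminingSets (DetSet MSField AgreeOn avgFamily)

/-- ★★★ **EVERY NON-D1 LEAF OF ✓`twoVolExp_orbit_images` AT def-Y's CHART, FROM THE KNIT TOKENS + (s-exp) + THE OF-RECORD FAMILY TOKEN + THE TWO FLAT DICTIONARIES** —
the N07∕P0 KNIT tokens (rng)(cov)(c→s)(min) + `S.RegimeTok` + domain letter (⟹ factorisation, ✓`rootFactorAt_of_tokens_chart`), (s-exp) «`chartCfg S (unitField B) = expChart 1 (X B)`
near `0`» (def-Y instance: `bg ≡ 1` + the Lie-algebra reality of the exponent), `C²` chart coordinates `X` at `0`, the of-record family token for `X` (members critical on their fibres +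
n07-e's submersion letter + fibre clause), (J-crit′), (J-cons′) ⟹ (C-wcg) ∧ (C-orb) ∧ (C-crit) ∧ (C-cons) for ALL `a l`, AND TokP9reg♭ᵣ.  No weak-criticality letter, no `H₁`, no (21) slice,
no selector.  CONDITIONAL; every letter DISPLAYED; nothing of [15] asserted. [cite: Balaban1985Variational, Thm 1 p.279, Prop. 6 p.295, Prop. 7 p.299, Prop. 9 p.309, (82)–(83) p.290, (176)–(178) p.306; Balaban1984PropagatorsII, (2.35) p.228; Balaban1988Convergent, (2.12) p.256; Balaban1987RG1, (4.35) p.290] -/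
theorem rootedReceipts_of_tokens_critOnFibreFamily [CompleteSpace 𝒴] (k K : ℕ) (hk : k + 1 ≤ (F.P K).m + (F.P K).K) (S : BgScheme F 2 𝒴 𝒵 K (k + 1))
    (hR : S.RegimeTok) (Kc : GaugeField (F.P K) (k + 1) (SU 2) → Set 𝒴)
    (range : ∀ V ∈ S.dom, ∀ A ∈ Kc V, S.chart V A ∈ bgReg F 2 K (k + 1) θ.εbg ∧ Averaging.iter (avOfRecord F 2 K) (k + 1) (S.chart V A) = V)
    (covers : ∀ V ∈ S.dom, ∀ U : GaugeField (F.P K) 0 (SU 2), U ∈ bgReg F 2 K (k + 1) θ.εbg →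
      Averaging.iter (avOfRecord F 2 K) (k + 1) U = V → ∃ A ∈ Kc V, OrbitRel (k + 1) (S.chart V A) U)
    (sol_of_isMinOn : ∀ V ∈ S.dom, ∀ A ∈ Kc V, IsMinOn (wilsonAction4 ∘ S.chart V) (Kc V) A →
      ‖A‖ ≤ S.ε₄ ∧ mapT (S.𝒢 V) 0 (S.W V) (S.J V) (S.𝔄 V) A = A)
    (star_mem : ∀ V ∈ S.dom, S.sol V ∈ Kc V) (star_isMinOn : ∀ V ∈ S.dom, IsMinOn (wilsonAction4 ∘ S.chart V) (Kc V) (S.sol V))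
    (hdom : letI := θ.instVβ₁; letI := θ.instVβ₂;
      ∀ᶠ B in 𝓝 (0 : Fin (F.P K).d → Site (F.P K) (k + 1) → θ.Vβ), unitField F θ k K B ∈ S.dom)
    {V : Type*} [NormedAddCommGroup V] [NormedSpace ℝ V] [FiniteDimensional ℝ V]
    (𝔹 : DetSet (F.P K)) (W : (Fin (F.P K).d → Site (F.P K) (k + 1) → θ.Vβ) → MSField (F.P K) (SU 2))
    (X : (Fin (F.P K).d → Site (F.P K) (k + 1) → θ.Vβ) → PBond (F.P K) 0 → lieSU (Fin 2))
    (Ψ : (PBond (F.P K) 0 → lieSU (Fin 2)) → V) (datum : (Fin (F.P K).d → Site (F.P K) (k + 1) → θ.Vβ) → V)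
    (hSX : letI := θ.instVβ₁; letI := θ.instVβ₂;
      (fun B => S.chartCfg (unitField F θ k K B)) =ᶠ[𝓝 (0 : Fin (F.P K).d → Site (F.P K) (k + 1) → θ.Vβ)]
        fun B => expChart (1 : GaugeField (F.P K) 0 (SU 2)) (X B))
    (hXc : letI := θ.instVβ₁; letI := θ.instVβ₂; ContDiffAt ℝ 2 X 0)
    (hfam : FlatCritOnFibreExpChartFamilyAt F θ k K 𝔹 W X Ψ datum) (Jcrit : FlatCritDictionary F k K Ψ) (Jcons : FlatConsDictionary F θ k K Ψ datum) :
    (∀ (a : θ.ιβ) (l : RespLabel F k K),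
      RootedResponseCriticalModGaugeAt F θ k K a l ∧ RootedResponseOrbitAt F θ k K a l ∧
        RootedResponseInvCriticalAt F θ k K a l ∧ RootedResponseConstraintModGaugeAt F θ k K a l) ∧
    letI := θ.instVβ₁; letI := θ.instVβ₂
    ContDiffAt ℝ 2 (fun B : Fin (F.P K).d → Site (F.P K) (k + 1) → θ.Vβ =>
      fun (b : PBond (F.P K) 0) (i i' : Fin 2) => ((recordBgField F θ k K B b : SU 2) : Matrix (Fin 2) (Fin 2) ℂ) i i') 0 := by
  have hfac := rootFactorAt_of_tokens_chart F θ k K hk S hR Kc range covers sol_of_isMinOn star_mem star_isMinOn hdom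
  exact ⟨fun a l => rootedReceipts_of_critOnFibreFamily F θ k K hk _ hfac 𝔹 W X Ψ datum hSX hfam Jcrit Jcons a l,
    tokP9reg_of_expChartFamily F θ k K _ hfac X hSX hXc⟩

end SchemeDocking

/-!
APPEND NOTE (porter ▶ PTC-1 g4, 2026-08-31, INTENT-59 = whole-file re-proposal of ✓p821863 under the append protocol): everything ABOVE this block is the accepted tree file byte-identical (= ◇
lens-1 g11 `LENS-1g11-TangentSocketDock-v1.lean` 533b5c8d + landing paragraph); BELOW: ◇ lens-1 g11's CANDIDATE 4 = the region of `nodeO-cover/LENS-1g11-TangentSocketDock-v3.lean` sha16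
ba6ee3cbd5128301 · 359 l. after `end SchemeDocking` VERBATIM (its own append docblock, §4d `section SchemeExp` 2 thm, §4e `section MinimalCritical` 4 thm; v1 ⊂ v3 byte-identical through v1 :180);
◆ CRIT-1 g37's cut + stamp of CANDIDATE 4: CANDIDATE 4 (§4d + §4e) — SAME-WALL: SURVIVES, §4e being the first DISCHARGE on this road (the family token's (hco) clause PROVED at the one-scale
determining set from the KNIT tokens + (s-exp)); J1′ ∕ J4 ∕ J5′ ∕ (Q-ord) STAMP PASS; CUT GO as INTENT-59 = ONE APPEND; axioms standard on ◆'s v3 run (nodeO STATUS 2026-08-31T11:41:10Z).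
`--supports stmt-QuantumFields-27238 --as helper` (NO `--workitem`).  HONEST (porter): bookkeeping + one Fermat step; CONDITIONAL over DISPLAYED letters inhabited nowhere; nothing of Bałaban
asserted, ported, discharged or refuted; (C-tab-opt) STRUCK; K0ᴬ stmt-QuantumFields-27238 ∕ K0⁷ 20541 OPEN — nothing of them proved; NODE O 0∕1; COUNT 8∕28 · K 1∕4 UNMOVED; finite 𝕋⁴ at fixed ε —
NOT continuum ∕ OS ∕ Clay; the Yang–Mills mass gap is NOT proved by any of this.
-/

/-! ## APPEND (lens-1 g11, CANDIDATE 4): §4d + §4e — two more displayed letters of the (R-a) road at def-Y's chart become bookkeeping ∕ PROVED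

§4d `chartCfg_eq_expChart_of_coe_eq` ((s-exp) POINTWISE at scheme level: unit background + a Lie-algebra presentation `X` of the exponent `i·ev(𝒜(V)+𝔄(V))` ⟹ `S.chartCfg V =
   expChart 1 X` — the Lie-algebra form of def-Y's `ChartSUTok`); `chartCfg_unitField_eventuallyEq_expChart` (the (s-exp) binder `S.chartCfg ∘ unitField =ᶠ[𝓝 0] expChart 1 ∘ X` FROM the two
   displayed scheme letters «`S.bg (unitField B) = 1`» and «`(X B b : M₂(ℂ)) = i·ev(𝒜 + 𝔄)(unitField B) b`» for `B` near `0`).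
§4e ★★ `isCritOnFibre_atScale_of_isBackground_bgReg` ((0.21)-minimal over the curve-open class (1.2) ⇒ critical on the one-scale fibre, n07-e's curve sense — Fermat);
   ★★★ `isCritOnFibre_chartCfg_of_tokens_chart` (the chart image of def-Y's fixed point is critical on the one-scale fibre, FROM the N07∕P0 KNIT tokens (rng)(cov)(min) via
   ✓`N07P0FixedPointIsRecordMinimiser.isBackground_chartCfg_of_tokens_chart`); ★★★ `eventually_isCritOnFibre_expChart_of_tokens` (the (hco) clause of the of-record family token on
   `atScale (k+1)` FROM the KNIT tokens + (s-exp)); ★★★ `rootedReceipts_of_tokens_atScale` (= `rootedReceipts_of_tokens_critOnFibreFamily` at `𝐁 = atScale (k+1)`, `W B (k+1) = unitField B`,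
   with the minimality∕criticality clause of the family token DISCHARGED by the KNIT — what stays displayed: KNIT tokens + `RegimeTok` + domain letter; (s-exp); `X 0 = 0`, `ContDiffAt ℝ 2 X 0`;
   the n07-e submersion letter of `Ψ` with the ONE-SCALE fibre clause and `DΨ` differentiable at `0`; the datum clause; (J-crit′); (J-cons′)).
HONEST — bookkeeping + one Fermat step; CONDITIONAL over DISPLAYED letters; nothing of [Balaban1985Variational] ∕ [Balaban1987RG1] ∕ [Balaban1988Convergent] asserted, ported or discharged. -/

/-! ### §4d  (s-exp) AT SCHEME LEVEL: a `BgScheme` chart image with unit background and Lie-algebra-valued exponent IS an exp-chart at `1` -/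

section SchemeExp

variable {𝒴 𝒵 : Type} [NormedAddCommGroup 𝒴] [NormedSpace ℂ 𝒴] [NormedAddCommGroup 𝒵] [NormedSpace ℂ 𝒵]

open T4AdjointCovarianceUnitary (lieSU expSU coe_expSU)

/-- **(s-exp), POINTWISE AT SCHEME LEVEL** (bookkeeping): if the background of the scheme at `V` is the unit configuration and the exponent `i·ev(𝒜(V) + 𝔄(V))` of the chart
image is presented by a Lie-algebra field `X` (the Lie-algebra form of def-Y's `ChartSUTok`: reality of the fixed point), then the chart image of the fixed point IS `expChart 1 X`
(«U = U′U₀, U′ = exp(iηA′)» with `U₀ = 1`). [cite: Balaban1985Variational, (15) p.280, (19) p.281, Prop. 6 p.295] -/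
theorem chartCfg_eq_expChart_of_coe_eq {K k' : ℕ} (S : BgScheme F 2 𝒴 𝒵 K k') {V : GaugeField (F.P K) k' (SU 2)} (hbg : S.bg V = 1)
    (X : PBond (F.P K) 0 → lieSU (Fin 2))
    (hX : ∀ b : PBond (F.P K) 0, ((X b : lieSU (Fin 2)) : Matrix (Fin 2) (Fin 2) ℂ) = Complex.I • S.ev (S.sol V + S.𝔄 V) b) :
    S.chartCfg V = expChart (1 : GaugeField (F.P K) 0 (SU 2)) X := by
  funext b
  have hexpo : S.expo V b = ((expSU (X b) : SU 2) : Matrix (Fin 2) (Fin 2) ℂ) := by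
    rw [coe_expSU, hX]
    rfl
  have hmem : S.expo V b ∈ Matrix.specialUnitaryGroup (Fin 2) ℂ := by
    rw [hexpo]
    exact (expSU (X b)).2
  have h1 : suOfMat 2 (S.expo V b) = expSU (X b) := by
    rw [suOfMat_of_mem hmem]
    exact Subtype.ext hexpo
  rw [BgScheme.chartCfg_apply, h1, hbg]
  show expSU (X b) * (1 : SU 2) = (1 : SU 2) * expSU (X b)
  rw [mul_one, one_mul]

/-- **(s-exp) AT K0, FROM DISPLAYED SCHEME LETTERS**: unit background and a Lie-algebra presentation `X B` of the exponent along the charted unit-lattice fields `unitField B`, both for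
`B` near `0` ⟹ `S.chartCfg ∘ unitField =ᶠ[𝓝 0] expChart 1 ∘ X` — the (s-exp) binder of `rootedReceipts_of_tokens_critOnFibreFamily`. CONDITIONAL; letters DISPLAYED.
[cite: Balaban1985Variational, (15) p.280, (19) p.281, Prop. 6 p.295, Prop. 9 p.309] -/
theorem chartCfg_unitField_eventuallyEq_expChart (k K : ℕ) (S : BgScheme F 2 𝒴 𝒵 K (k + 1))
    (X : (Fin (F.P K).d → Site (F.P K) (k + 1) → θ.Vβ) → PBond (F.P K) 0 → lieSU (Fin 2))
    (hbg : letI := θ.instVβ₁; letI := θ.instVβ₂;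
      ∀ᶠ B in 𝓝 (0 : Fin (F.P K).d → Site (F.P K) (k + 1) → θ.Vβ), S.bg (unitField F θ k K B) = 1)
    (hX : letI := θ.instVβ₁; letI := θ.instVβ₂;
      ∀ᶠ B in 𝓝 (0 : Fin (F.P K).d → Site (F.P K) (k + 1) → θ.Vβ), ∀ b : PBond (F.P K) 0,
        ((X B b : lieSU (Fin 2)) : Matrix (Fin 2) (Fin 2) ℂ) =
          Complex.I • S.ev (S.sol (unitField F θ k K B) + S.𝔄 (unitField F θ k K B)) b) :
    letI := θ.instVβ₁; letI := θ.instVβ₂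
    (fun B => S.chartCfg (unitField F θ k K B)) =ᶠ[𝓝 (0 : Fin (F.P K).d → Site (F.P K) (k + 1) → θ.Vβ)]
      fun B => expChart (1 : GaugeField (F.P K) 0 (SU 2)) (X B) := by
  letI := θ.instVβ₁; letI := θ.instVβ₂
  filter_upwards [hbg, hX] with B hB hXB
  exact chartCfg_eq_expChart_of_coe_eq F S hB (X B) hXB

end SchemeExp

/-! ### §4e  (0.21)-MINIMALITY OVER THE CLASS (1.2) ⇒ CRITICAL ON THE ONE-SCALE FIBRE; the (hco) clause of the of-record family token FROM THE N07∕P0 KNIT TOKENS -/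

section MinimalCritical

variable {𝒴 𝒵 : Type} [NormedAddCommGroup 𝒴] [NormedSpace ℂ 𝒴] [NormedAddCommGroup 𝒵] [NormedSpace ℂ 𝒵]

open T4AdjointCovarianceUnitary (lieSU expSU coe_expSU)
open B15DeterminingSets (DetSet MSField AgreeOn avgFamily IsMinimizer atScale isMinimizer_atScale_iff)

/-- ★★ **«(0.21)-MINIMAL OVER THE CLASS (1.2) ⇒ CRITICAL ON THE ONE-SCALE FIBRE»**: a minimiser `U` of the Wilson action over the regularity class `bgReg F N K k ε`
(`|U(∂p) − 1| < ε η_k²`, [I] (1.2) — finitely many STRICT inequalities, hence curve-open by n07-e's ✓`eventually_plaqSmallOn`) on the one-scale fibre `{Ū^k = V}` (the tree's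
`IsBackground`, [I] (0.21)) is a critical configuration of (5) on that fibre in n07-e's curve sense (`IsCritOnFibre` at the one-scale determining set `atScale k` with `W k = V`):
a curve through `U` differentiable at `0` stays in the open class, and Fermat applies (✓`deriv_wilsonAction4_eq_zero_of_isMinimizer`).  The one-scale companion of n07-e's
✓`isCritOnFibre_of_isMinimizer_class6`. [cite: Balaban1987RG1, (0.21) p.256, (1.2) p.260; Balaban1985Variational, (5)–(6) p.278, p.299 («minimal configuration»), p.300 (Sect. F); Balaban1988Convergent, (2.12) p.256] -/
theorem isCritOnFibre_atScale_of_isBackground_bgReg {N : ℕ} [NeZero N] {K k : ℕ} {ε : ℝ} {V : GaugeField (F.P K) k (SU N)}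
    {U : GaugeField (F.P K) 0 (SU N)} (h : IsBackground (avOfRecord F N K) (bgReg F N K k ε) k V U)
    (W : MSField (F.P K) (SU N)) (hW : W k = V) : IsCritOnFibre F N K (atScale k) W U := by
  intro γ h0 hd hc a ha
  have hmin : IsMinimizer (avOfRecord F N K) (bgReg F N K k ε) (atScale k) W U := by
    rw [isMinimizer_atScale_iff, hW]
    exact h
  have hγ : ContinuousAt (fun t (b : PBond (F.P K) 0) => γ t b) 0 := continuousAt_of_differentiableAt_val hd
  have hU : PlaqSmallOn (Set.univ : Set (Plaq (F.P K) 0)) (ε * (F.P K).eta k ^ 2) (γ 0) := by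
    rw [h0]
    exact fun p _ => h.2.1 p
  have hreg : ∀ᶠ t in 𝓝 (0 : ℝ), γ t ∈ bgReg F N K k ε :=
    (eventually_plaqSmallOn hγ hU).mono fun t ht p => ht p (Set.mem_univ p)
  exact deriv_wilsonAction4_eq_zero_of_isMinimizer hmin h0 hreg hc ha

/-- ★★★ **THE CHART IMAGE OF def-Y's FIXED POINT IS CRITICAL ON THE ONE-SCALE FIBRE, FROM THE N07∕P0 KNIT TOKENS** (rng)(cov)(min) at `S.chart V`: the KNIT gives
`IsBackground … V (S.chartCfg V)` (✓`N07P0FixedPointIsRecordMinimiser.isBackground_chartCfg_of_tokens_chart`), and minimal ⇒ critical over the open class (1.2).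
[cite: Balaban1985Variational, Thm 1 (8) p.279, Prop. 6 p.295, Prop. 7 p.299, (5)–(6) p.278; Balaban1987RG1, (0.21) p.256, (1.2) p.260; Balaban1988Convergent, (2.12) p.256] -/
theorem isCritOnFibre_chartCfg_of_tokens_chart {N : ℕ} [NeZero N] {K k : ℕ} {ε : ℝ} (S : BgScheme F N 𝒴 𝒵 K k)
    {V : GaugeField (F.P K) k (SU N)} {Kc : Set 𝒴}
    (range : ∀ A ∈ Kc, S.chart V A ∈ bgReg F N K k ε ∧ Averaging.iter (avOfRecord F N K) k (S.chart V A) = V)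
    (covers : ∀ U : GaugeField (F.P K) 0 (SU N), U ∈ bgReg F N K k ε → Averaging.iter (avOfRecord F N K) k U = V →
      ∃ A ∈ Kc, OrbitRel k (S.chart V A) U)
    (star_mem : S.sol V ∈ Kc) (star_isMinOn : IsMinOn (wilsonAction4 ∘ S.chart V) Kc (S.sol V))
    (W : MSField (F.P K) (SU N)) (hW : W k = V) :
    IsCritOnFibre F N K (atScale k) W (S.chartCfg V) :=
  isCritOnFibre_atScale_of_isBackground_bgReg F
    (N07P0FixedPointIsRecordMinimiser.isBackground_chartCfg_of_tokens_chart range covers star_mem star_isMinOn) W hW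

/-- ★★★ **THE (hco) CLAUSE OF THE OF-RECORD FAMILY TOKEN AT K0 on the one-scale determining set `atScale (k+1)`, FROM THE KNIT TOKENS + (s-exp)**: for `B` near `0` the member
`expChart 1 (X B) = S.chartCfg (unitField B)` is critical on the fibre `{Ū^{k+1} = unitField B}`. [cite: Balaban1985Variational, Thm 1 p.279, (5)–(6) p.278; Balaban1987RG1, (0.21) p.256, (1.2) p.260] -/
theorem eventually_isCritOnFibre_expChart_of_tokens (k K : ℕ) (S : BgScheme F 2 𝒴 𝒵 K (k + 1))
    (Kc : GaugeField (F.P K) (k + 1) (SU 2) → Set 𝒴)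
    (range : ∀ V ∈ S.dom, ∀ A ∈ Kc V, S.chart V A ∈ bgReg F 2 K (k + 1) θ.εbg ∧ Averaging.iter (avOfRecord F 2 K) (k + 1) (S.chart V A) = V)
    (covers : ∀ V ∈ S.dom, ∀ U : GaugeField (F.P K) 0 (SU 2), U ∈ bgReg F 2 K (k + 1) θ.εbg →
      Averaging.iter (avOfRecord F 2 K) (k + 1) U = V → ∃ A ∈ Kc V, OrbitRel (k + 1) (S.chart V A) U)
    (star_mem : ∀ V ∈ S.dom, S.sol V ∈ Kc V) (star_isMinOn : ∀ V ∈ S.dom, IsMinOn (wilsonAction4 ∘ S.chart V) (Kc V) (S.sol V))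
    (hdom : letI := θ.instVβ₁; letI := θ.instVβ₂;
      ∀ᶠ B in 𝓝 (0 : Fin (F.P K).d → Site (F.P K) (k + 1) → θ.Vβ), unitField F θ k K B ∈ S.dom)
    (W : (Fin (F.P K).d → Site (F.P K) (k + 1) → θ.Vβ) → MSField (F.P K) (SU 2)) (hW : ∀ B, W B (k + 1) = unitField F θ k K B)
    (X : (Fin (F.P K).d → Site (F.P K) (k + 1) → θ.Vβ) → PBond (F.P K) 0 → lieSU (Fin 2))
    (hSX : letI := θ.instVβ₁; letI := θ.instVβ₂;
      (fun B => S.chartCfg (unitField F θ k K B)) =ᶠ[𝓝 (0 : Fin (F.P K).d → Site (F.P K) (k + 1) → θ.Vβ)]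
        fun B => expChart (1 : GaugeField (F.P K) 0 (SU 2)) (X B)) :
    letI := θ.instVβ₁; letI := θ.instVβ₂
    ∀ᶠ B in 𝓝 (0 : Fin (F.P K).d → Site (F.P K) (k + 1) → θ.Vβ),
      IsCritOnFibre F 2 K (atScale (k + 1)) (W B) (expChart (1 : GaugeField (F.P K) 0 (SU 2)) (X B)) := by
  letI := θ.instVβ₁; letI := θ.instVβ₂
  filter_upwards [hdom, hSX] with B hB hS
  rw [← hS]
  exact isCritOnFibre_chartCfg_of_tokens_chart F S (range _ hB) (covers _ hB) (star_mem _ hB) (star_isMinOn _ hB) (W B) (hW B)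

/-- ★★★ **ROOTED RECEIPTS + `TokP9reg` AT def-Y's CHART ON THE ONE-SCALE FIBRE, WITH THE MINIMALITY CLAUSE DISCHARGED BY THE KNIT**: as
`rootedReceipts_of_tokens_critOnFibreFamily` at `𝐁 = atScale (k+1)`, `W B (k+1) = unitField B`, but the (hco) clause of the of-record family token is no longer a binder — it is
PROVED from the KNIT tokens (rng)(cov)(min) + (s-exp) (`eventually_isCritOnFibre_expChart_of_tokens`).  What stays DISPLAYED: the KNIT tokens + `RegimeTok` + domain letter; (s-exp);
`X 0 = 0`, `ContDiffAt ℝ 2 X 0`; the n07-e submersion letter of `Ψ` with the one-scale fibre clause and `DΨ` differentiable at `0`; the datum clause; (J-crit′); (J-cons′).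
CONDITIONAL; nothing of [15] asserted. [cite: Balaban1985Variational, Thm 1 p.279, Prop. 6 p.295, (82)–(83) p.290, Prop. 8 p.304, Prop. 9 p.309, (174) p.305, (177)–(182) p.306–307; Balaban1987RG1, (0.21) p.256, (1.1)–(1.2) p.260, (2.3)–(2.4) p.265; Balaban1988Convergent, (2.10)–(2.12) p.256] -/
theorem rootedReceipts_of_tokens_atScale [CompleteSpace 𝒴] (k K : ℕ) (hk : k + 1 ≤ (F.P K).m + (F.P K).K) (S : BgScheme F 2 𝒴 𝒵 K (k + 1))
    (hR : S.RegimeTok) (Kc : GaugeField (F.P K) (k + 1) (SU 2) → Set 𝒴)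
    (range : ∀ V ∈ S.dom, ∀ A ∈ Kc V, S.chart V A ∈ bgReg F 2 K (k + 1) θ.εbg ∧ Averaging.iter (avOfRecord F 2 K) (k + 1) (S.chart V A) = V)
    (covers : ∀ V ∈ S.dom, ∀ U : GaugeField (F.P K) 0 (SU 2), U ∈ bgReg F 2 K (k + 1) θ.εbg →
      Averaging.iter (avOfRecord F 2 K) (k + 1) U = V → ∃ A ∈ Kc V, OrbitRel (k + 1) (S.chart V A) U)
    (sol_of_isMinOn : ∀ V ∈ S.dom, ∀ A ∈ Kc V, IsMinOn (wilsonAction4 ∘ S.chart V) (Kc V) A →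
      ‖A‖ ≤ S.ε₄ ∧ mapT (S.𝒢 V) 0 (S.W V) (S.J V) (S.𝔄 V) A = A)
    (star_mem : ∀ V ∈ S.dom, S.sol V ∈ Kc V) (star_isMinOn : ∀ V ∈ S.dom, IsMinOn (wilsonAction4 ∘ S.chart V) (Kc V) (S.sol V))
    (hdom : letI := θ.instVβ₁; letI := θ.instVβ₂;
      ∀ᶠ B in 𝓝 (0 : Fin (F.P K).d → Site (F.P K) (k + 1) → θ.Vβ), unitField F θ k K B ∈ S.dom)
    {V : Type*} [NormedAddCommGroup V] [NormedSpace ℝ V] [FiniteDimensional ℝ V]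
    (W : (Fin (F.P K).d → Site (F.P K) (k + 1) → θ.Vβ) → MSField (F.P K) (SU 2)) (hW : ∀ B, W B (k + 1) = unitField F θ k K B)
    (X : (Fin (F.P K).d → Site (F.P K) (k + 1) → θ.Vβ) → PBond (F.P K) 0 → lieSU (Fin 2))
    (Ψ : (PBond (F.P K) 0 → lieSU (Fin 2)) → V) (datum : (Fin (F.P K).d → Site (F.P K) (k + 1) → θ.Vβ) → V)
    (hSX : letI := θ.instVβ₁; letI := θ.instVβ₂;
      (fun B => S.chartCfg (unitField F θ k K B)) =ᶠ[𝓝 (0 : Fin (F.P K).d → Site (F.P K) (k + 1) → θ.Vβ)]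
        fun B => expChart (1 : GaugeField (F.P K) 0 (SU 2)) (X B))
    (hX₀ : letI := θ.instVβ₁; letI := θ.instVβ₂; X 0 = 0) (hXc : letI := θ.instVβ₁; letI := θ.instVβ₂; ContDiffAt ℝ 2 X 0)
    (hΨd : DifferentiableAt ℝ (fun Y => fderiv ℝ Ψ Y) 0)
    (hsub : letI := θ.instVβ₁; letI := θ.instVβ₂;
      ∀ᶠ B in 𝓝 (0 : Fin (F.P K).d → Site (F.P K) (k + 1) → θ.Vβ),
        HasStrictFDerivAt Ψ (fderiv ℝ Ψ (X B)) (X B) ∧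
          ((fderiv ℝ Ψ (X B) : (PBond (F.P K) 0 → lieSU (Fin 2)) →ₗ[ℝ] V).range = ⊤) ∧
          ∀ Y, Ψ Y = Ψ (X B) →
            AgreeOn (atScale (k + 1)) (avgFamily (avOfRecord F 2 K) (expChart (1 : GaugeField (F.P K) 0 (SU 2)) Y)) (W B))
    (hdat : letI := θ.instVβ₁; letI := θ.instVβ₂;
      ∀ᶠ B in 𝓝 (0 : Fin (F.P K).d → Site (F.P K) (k + 1) → θ.Vβ), Ψ (X B) = datum B)
    (Jcrit : FlatCritDictionary F k K Ψ) (Jcons : FlatConsDictionary F θ k K Ψ datum) :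
    (∀ (a : θ.ιβ) (l : RespLabel F k K),
      RootedResponseCriticalModGaugeAt F θ k K a l ∧ RootedResponseOrbitAt F θ k K a l ∧
        RootedResponseInvCriticalAt F θ k K a l ∧ RootedResponseConstraintModGaugeAt F θ k K a l) ∧
    letI := θ.instVβ₁; letI := θ.instVβ₂
    ContDiffAt ℝ 2 (fun B : Fin (F.P K).d → Site (F.P K) (k + 1) → θ.Vβ =>
      fun (b : PBond (F.P K) 0) (i i' : Fin 2) => ((recordBgField F θ k K B b : SU 2) : Matrix (Fin 2) (Fin 2) ℂ) i i') 0 := by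
  letI := θ.instVβ₁; letI := θ.instVβ₂
  have hco := eventually_isCritOnFibre_expChart_of_tokens F θ k K S Kc range covers star_mem star_isMinOn hdom W hW X hSX
  have hfam : FlatCritOnFibreExpChartFamilyAt F θ k K (atScale (k + 1)) W X Ψ datum :=
    ⟨hX₀, hXc.differentiableAt (by norm_num), hΨd, hco, hsub, hdat⟩
  exact rootedReceipts_of_tokens_critOnFibreFamily F θ k K hk S hR Kc range covers sol_of_isMinOn star_mem star_isMinOn hdom
    (atScale (k + 1)) W X Ψ datum hSX hXc hfam Jcrit Jcons

end MinimalCritical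

end Summit.QuantumFields.YangMills.Theorems.K0AxCtabUniq

end
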